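import Mathlib
import Literature.MathematicalPhysics.QuantumFieldTheory.Balaban1983to89.T4HybridMatching

/-!
# NE9FluctuationStep — scheme (IV) for the spine estimate NE9 (node U3, cell `pub-balaban`, rung (B)+1 on a finite T⁴):
# the LAST-COUPLING and OLD-ACTION Lipschitz moduli of a fluctuation step of the PRINTED FORM, by REAL-VARIABLE
# bookkeeping at a POSITIVE fluctuation measure — no complex coupling, no analyticity radius, no smallness rider

HONEST FRAMING (T4-DAG PAGE 1).  The cell's T⁴ target is existence AND uniqueness of the `ε → 0` limit of gauge-invariant
observables of pure YM₄ on a FIXED finite torus, conditional on (B) and `BetaPertH` and on nine NEW spine estimates, none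
of them printed; it is NOT infinite volume, NOT the mass gap, NOT the Clay problem.  This leaf is OUR OWN WORK (placement
rule 2026-08-19: Summits-side), written by the prover seat of binder row NE9 (`HOME/BINDER-OWNERS.md`; unit
`b2b-balaban-t4-ne9-p1-g17`).  It proves NOTHING about Bałaban's constructed functionals `𝐄^{(j)}(X; g⃗, U)` (they are not
objects of the tree) and it does NOT discharge `T4OutputRate.NE9`; the spine count is unchanged by it.

WHAT IT IS.  Spine estimate NE9 (`Literature.….T4OutputRate.NE9` ∧ `….FadingMemory`) is, by the lineage's accepted
conditional kernel package (`T4CouplingAnalyticity.stepTransferV_of_analyticOn`, `T4HistoryLipschitzRecursion.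
ne9_and_fadingMemory_of_geometricStep`, `T4HistoryLipschitzLastCoupling.ne9_and_fadingMemory_of_decay_holo`), reduced to ONE
one-step statement about the small-field renormalization step: a Lipschitz modulus of the NEW term in the LAST coupling
`g_k` (cell names NE9-STEP / [H-dil-N] / [H-vert-N]) plus a contraction of the OLD-term channel (NE9-FADE).  Every scheme
recorded so far for the last-coupling modulus (cell record `t4/T4-EST-NE9-P1.md` §21.2: (I) exact dilation, (II) complex
Taylor coefficients at the frozen cut-off, (III) the alternative cut-off of [Balaban1987RG1] p. 266) COMPLEXIFIES the
coupling and runs a Cauchy estimate.  This leaf records and kernel-checks scheme (IV): for a step of the printed FORM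
([Balaban1987RG1] (2.13) p. 268: *"𝐄^{(k+1)}(g_k, U_{k+1}) = log ∫ dμ_{C^{(k)}}(B)χ_k exp[𝐏^{(k)}(g_k, U_{k+1}, B) + {…}]"*,
the curly bracket being the FLUCTUATION DIFFERENCE `{𝐄_k(U_k(exp i[g_kCB − hD̃(g_kCB)]V^{(k)})) − 𝐄_k(U_k(V^{(k)}))}` of
(2.12) p. 268) evaluated at a REAL background, with a POSITIVE coupling-free fluctuation measure and a FROZEN cut-off set,
* (§1) the functional `F ↦ log ∫_χ e^{F} dμ` is 1-Lipschitz in the sup norm over the cut-off set (`abs_logFluct_sub_le`;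
  the tree's `T4HybridMatching.abs_log_integral_exp_sub_le` at `c = 0`) — the EXACT nonlinearity cost of the printed form:
  constant one, no radius, no smallness;
* (§2) hence the LAST-COUPLING modulus of the step is `mP + CU·cB` (`abs_step_sub_step_le_of_lastCoupling`), where `mP` is
  the Lipschitz constant of the explicit vertex part `𝐏^{(k)}(·, U, B)` on the coupling window, `cB` the amplitude of the
  background shift per unit coupling on the cut-off set (the printed small-field bound `|B(b)| < ε₁/g_k`, [Balaban1988RG2Cluster]
  (1.34) p. 9, makes it `ε₁‖C‖/g_k`: a `1/g_k` modulus in g, a BOUNDED modulus in `t = 1/g²`), and `CU` the Lipschitz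
  constant of the OLD ACTION IN THE BACKGROUND — the printed-ingredient shape `T4OutputRate.LipBackground` of node U3
  ([Balaban1988Convergent] (2.27)(ii) p. 259 + a Cauchy estimate in U): THE LAST COUPLING ENTERS THE OLD ACTION ONLY AS
  THE AMPLITUDE OF A BACKGROUND SHIFT, so its modulus there IS a background modulus;
* (§2) and the OLD-ACTION channel is 1-Lipschitz in the fluctuation-difference seminorm (`abs_step_sub_step_le_of_oldAction`):
  at the global, positive-measure level the hypotheses (W2) «analyticity of the step in the old activity with margin ϱ» and
  (W4) «4M₂/ϱ < 1 − ω₀» of the lineage's `ne9_of_analyticStep` are not needed at all — they are LOCALIZATION costs;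
* (§3) the two channels together give the one-step history inequality in the majorant format of
  `T4HistoryLipschitzRecursion.StepLipschitz` for ONE step (`abs_out_sub_out_le`): new-term discrepancy ≤ `(mP + CU·cB)·|g_k −
  g′_k|` + (fluctuation difference of the old-action discrepancy), the second summand being exactly where NE9-FADE's
  contraction must be fed in.

WHAT IT IS NOT (the census entry E12 of `t4/T4-EST-NE9-P1.md`, gen 17).  NE9 needs the modulus for the LOCALIZED pieces
`𝐄^{(k+1)}(X; ·)` with the `e^{−κd_{k+1}(X)}` factor, and the induction that produces fading memory runs on the COMPLEX
spaces `U^c_j(X, α₀, α₁)` (the contraction of the old-term discrepancy is obtained by a Cauchy estimate in the background,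
which needs the discrepancy bounded on the complex space); there the integrand of (2.13) is complex, positivity is lost
([Balaban1988RG2Cluster] p. 15: *"For the pair (U, 0) the operators are symmetric, and the measure is positive, and then the
estimates are simpler. The general case is handled by a perturbative argument."*), and §1 is replaced by the LINEAR RESPONSE
of the cluster expansion of [Balaban1988RG2Cluster] §2 to a perturbation of its input activities — inspection-level, NOT
PRINTED, the same class as the old-action channel (cell GAPS G-ne9p1-2 / record §7 (L6)).  Scheme (IV) therefore does not
close NE9; what it shows is that NO COMPLEXIFICATION OF THE COUPLING is needed anywhere (the framing «print complexifies
U, J, σ, τ, never g_k» is beside the point), and that the last-coupling wall (W1) is {`LipBackground` (a binder node U3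
already carries) + explicit vertices + the cut-off motion NE9-CUT + the expansion's linear response}.  The cut-off is FROZEN
here: the motion of `χ_k = Πχ(|B(b)| < ε₁/g_k)` with `g_k` (cell gap NE9-CUT, a small-field shell estimate) is a separate,
additive term not modelled in this leaf.

Sources quoted (manuscripts UNDER ADJUDICATION by the cell; nothing printed in them is used as a fact here — the quotations
LOCATE the form being modelled): T. Bałaban, *Renormalization group approach to lattice gauge field theories. I*, Commun.
Math. Phys. **109** (1987) 249–301 [Balaban1987RG1], (2.12)–(2.13) p. 268, p. 263; *II*, Commun. Math. Phys. **116** (1988)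
1–22 [Balaban1988RG2Cluster], (1.33)–(1.36) p. 9, p. 15; *Convergent renormalization expansions for lattice gauge theories*,
Commun. Math. Phys. **119** (1988) 243–285 [Balaban1988Convergent], (2.27)–(2.28) p. 259.  Mathlib + one tree lemma
(`T4HybridMatching.abs_log_integral_exp_sub_le`, [folklore]); every declaration below is [folklore] real analysis.
-/

namespace Summit.QuantumFields.BalabanUV.T4Continuum.NE9FluctuationStep

open MeasureTheory
open Literature.MathematicalPhysics.QuantumFieldTheory.Balaban1983to89

variable {Ω : Type*} [MeasurableSpace Ω]

/-! ## §1 The log-fluctuation functional `F ↦ log ∫_S e^F dμ` and its exact Lipschitz property -/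

/-- The LOG-FLUCTUATION INTEGRAL of an exponent `F` over a cut-off set `S` of fluctuation fields with respect to a
(positive, coupling-free) fluctuation measure `μ`: `log ∫_{B ∈ S} e^{F(B)} dμ(B)` — the outer operation of the printed
form [Balaban1987RG1] (2.13) p. 268 (there `μ = dμ_{C^{(k)}}`, `S = {χ_k = 1}`). [folklore] -/
noncomputable def logFluct (μ : Measure Ω) (S : Set Ω) (F : Ω → ℝ) : ℝ :=
  Real.log (∫ B in S, Real.exp (F B) ∂μ)

/-- Exponentials of an exponent bounded on a measurable cut-off set are integrable over it under a finite measure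
(the integrability side condition of `abs_logFluct_sub_le`, discharged from a sup bound). [folklore] -/
theorem integrable_exp_restrict (μ : Measure Ω) [IsFiniteMeasure μ] {S : Set Ω} (hS : MeasurableSet S)
    {F : Ω → ℝ} (hF : AEStronglyMeasurable F (μ.restrict S)) {M : ℝ} (hM : ∀ B ∈ S, |F B| ≤ M) :
    Integrable (fun B => Real.exp (F B)) (μ.restrict S) := by
  refine (integrable_const (Real.exp M)).mono' (Real.continuous_exp.comp_aestronglyMeasurable hF) ?_
  refine (ae_restrict_mem hS).mono fun B hB => ?_
  rw [Real.norm_eq_abs, abs_of_pos (Real.exp_pos _)]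
  exact Real.exp_le_exp.mpr ((le_abs_self _).trans (hM B hB))

/-- The fluctuation integral of a bounded exponent over a cut-off set of positive measure is positive (the positivity side
condition of `abs_logFluct_sub_le`). [folklore] -/
theorem fluctIntegral_pos (μ : Measure Ω) {S : Set Ω} (hS0 : μ S ≠ 0) {F : Ω → ℝ}
    (hint : Integrable (fun B => Real.exp (F B)) (μ.restrict S)) :
    0 < ∫ B in S, Real.exp (F B) ∂μ := by
  haveI : NeZero (μ.restrict S) := ⟨fun h => hS0 (Measure.restrict_eq_zero.mp h)⟩
  exact integral_exp_pos hint

/-- **`F ↦ log ∫_S e^F dμ` IS 1-LIPSCHITZ IN THE SUP NORM OVER THE CUT-OFF SET.**  If `|F B − F′ B| ≤ r` for every field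
`B` of the cut-off set `S` (measurable), both exponentials are integrable over `S` and the first fluctuation integral is
positive, then `|logFluct μ S F − logFluct μ S F′| ≤ r`.  The exact nonlinearity cost of the printed form (2.13): constant
ONE, no analyticity radius, no smallness — it uses only the POSITIVITY of the fluctuation measure (available at real
backgrounds; lost on the complex spaces `U^c`, [Balaban1988RG2Cluster] p. 15).  One line from the tree's
`T4HybridMatching.abs_log_integral_exp_sub_le` (at `c = 0`). [folklore] -/
theorem abs_logFluct_sub_le {μ : Measure Ω} {S : Set Ω} (hS : MeasurableSet S) {F F' : Ω → ℝ} {r : ℝ}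
    (hint : Integrable (fun B => Real.exp (F B)) (μ.restrict S))
    (hint' : Integrable (fun B => Real.exp (F' B)) (μ.restrict S))
    (hpos : 0 < ∫ B in S, Real.exp (F B) ∂μ) (h : ∀ B ∈ S, |F B - F' B| ≤ r) :
    |logFluct μ S F - logFluct μ S F'| ≤ r := by
  have hae : ∀ᵐ B ∂μ.restrict S, |F' B - F B - 0| ≤ r :=
    (ae_restrict_mem hS).mono fun B hB => by rw [sub_zero, abs_sub_comm]; exact h B hB
  have key := T4HybridMatching.abs_log_integral_exp_sub_le hint hint' hpos hae
  rw [sub_zero] at key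
  rw [abs_sub_comm]
  exact key

/-! ## §2 The fluctuation step of the printed form and its two channels -/

/-- DATA OF A FLUCTUATION STEP OF THE PRINTED FORM [Balaban1987RG1] (2.12)–(2.13) p. 268, over abstract carriers: a space
`Ω` of fluctuation fields `B` with a (positive, coupling-free) measure `μ = dμ_{C^{(k)}}`; the cut-off set `cut = {χ_k = 1}`
(FROZEN: its motion with the coupling, cell gap NE9-CUT, is not modelled); the explicit vertex part
`vertex s U B = 𝐏^{(k)}(s, U_{k+1}, B)` as a function of the last coupling `s`, the background `U` and the field; and the
BACKGROUND SHIFT `shift s B U = U_k(exp i[sCB − hD̃(sCB)]V^{(k)})` seen by the old action — the ONLY place where the last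
coupling meets the old action.  Nothing of Bałaban's construction is modelled: the fields are data.
[folklore] -/
structure FluctStep (Ω : Type*) [MeasurableSpace Ω] (Bg : Type*) where
  /-- the fluctuation measure `dμ_{C^{(k)}}` (coupling-free) -/
  μ : Measure Ω
  /-- the small-field cut-off set `{χ_k = 1}` (frozen) -/
  cut : Set Ω
  /-- the explicit vertex part `𝐏^{(k)}(s, U, B)` -/
  vertex : ℝ → Bg → Ω → ℝ
  /-- the background shift `U ↦ U_k(exp i[sCB − hD̃(sCB)]V^{(k)})` at last coupling `s` and fluctuation `B` -/
  shift : ℝ → Ω → Bg → Bg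

variable {Bg : Type*}

/-- The EXPONENT of the step at last coupling `s`, old action `E` (a function of the background), background `U` and
fluctuation field `B`: `𝐏^{(k)}(s, U, B) + {E(shift s B U) − E(U)}` — the square bracket of (2.13) with the curly bracket
of (2.12) p. 268. [folklore] -/
def FluctStep.exponent (D : FluctStep Ω Bg) (E : Bg → ℝ) (s : ℝ) (U : Bg) (B : Ω) : ℝ :=
  D.vertex s U B + (E (D.shift s B U) - E U)

/-- The NEW TERM produced by the step (un-normalised; the printed normalisation `log N_k″ = 𝐄^{(k+1)}(g_k, 1)`, (2.14)
p. 268, is the same functional at the unit background and at most doubles every modulus below):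
`step D E s U = log ∫_cut exp[exponent] dμ`. [folklore] -/
noncomputable def FluctStep.step (D : FluctStep Ω Bg) (E : Bg → ℝ) (s : ℝ) (U : Bg) : ℝ :=
  logFluct D.μ D.cut (D.exponent E s U)

/-- Integrability of the step's integrand from a sup bound on the exponent over the cut-off set (finite fluctuation
measure, measurable cut-off set, a.e.-strongly measurable exponent); with `fluctIntegral_pos` this discharges the two side
conditions of the channel theorems below. [folklore] -/
theorem FluctStep.integrable_exp_exponent (D : FluctStep Ω Bg) [IsFiniteMeasure D.μ] (hcut : MeasurableSet D.cut)
    {E : Bg → ℝ} {s : ℝ} {U : Bg} (hmeas : AEStronglyMeasurable (D.exponent E s U) (D.μ.restrict D.cut)) {M : ℝ}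
    (hM : ∀ B ∈ D.cut, |D.exponent E s U B| ≤ M) :
    Integrable (fun B => Real.exp (D.exponent E s U B)) (D.μ.restrict D.cut) :=
  integrable_exp_restrict D.μ hcut hmeas hM

/-- **THE LAST-COUPLING CHANNEL (scheme (IV)).**  Let the vertex part be `mP`-Lipschitz in the last coupling between `s`
and `s′` on the cut-off set, let the background shift move by at most `cB·|s − s′|` in a closeness gauge on backgrounds
(printed small-field bound `|B(b)| < ε₁/g_k` ⇒ `cB = ε₁‖C‖/g_k`-type), and let the OLD ACTION be `CU`-Lipschitz in the
background for that gauge (node U3's printed-ingredient shape `T4OutputRate.LipBackground`, here at the global level).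
Then the new term is `(mP + CU·cB)`-Lipschitz in the last coupling between `s` and `s′`:
`|step D E s U − step D E s′ U| ≤ (mP + CU·cB)·|s − s′|`.  No complex coupling, no radius, no smallness. [folklore] -/
theorem FluctStep.abs_step_sub_step_le_of_lastCoupling (D : FluctStep Ω Bg) (hcut : MeasurableSet D.cut)
    (gauge : Bg → Bg → ℝ) {E : Bg → ℝ} {s s' : ℝ} {U : Bg}
    (hint : Integrable (fun B => Real.exp (D.exponent E s U B)) (D.μ.restrict D.cut))
    (hint' : Integrable (fun B => Real.exp (D.exponent E s' U B)) (D.μ.restrict D.cut))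
    (hpos : 0 < ∫ B in D.cut, Real.exp (D.exponent E s U B) ∂D.μ)
    {mP cB CU : ℝ} (hP : ∀ B ∈ D.cut, |D.vertex s U B - D.vertex s' U B| ≤ mP * |s - s'|)
    (hshift : ∀ B ∈ D.cut, gauge (D.shift s B U) (D.shift s' B U) ≤ cB * |s - s'|)
    (hE : ∀ V V' : Bg, |E V - E V'| ≤ CU * gauge V V') (hCU : 0 ≤ CU) :
    |D.step E s U - D.step E s' U| ≤ (mP + CU * cB) * |s - s'| := by
  refine abs_logFluct_sub_le hcut hint hint' hpos fun B hB => ?_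
  have h1 := hP B hB
  have h2 : |E (D.shift s B U) - E (D.shift s' B U)| ≤ CU * (cB * |s - s'|) :=
    (hE _ _).trans (mul_le_mul_of_nonneg_left (hshift B hB) hCU)
  have heq : D.exponent E s U B - D.exponent E s' U B =
      (D.vertex s U B - D.vertex s' U B) + (E (D.shift s B U) - E (D.shift s' B U)) := by
    simp only [FluctStep.exponent]; ring
  rw [heq]
  calc |D.vertex s U B - D.vertex s' U B + (E (D.shift s B U) - E (D.shift s' B U))|
      ≤ |D.vertex s U B - D.vertex s' U B| + |E (D.shift s B U) - E (D.shift s' B U)| := abs_add_le _ _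
    _ ≤ mP * |s - s'| + CU * (cB * |s - s'|) := add_le_add h1 h2
    _ = (mP + CU * cB) * |s - s'| := by ring

/-- **THE OLD-ACTION CHANNEL.**  At fixed last coupling and background, the new term is 1-Lipschitz in the old action for the
FLUCTUATION-DIFFERENCE seminorm over the cut-off set: if `|(E(shift s B U) − E(U)) − (E′(shift s B U) − E′(U))| ≤ r` for
every `B` in the cut-off set then `|step D E s U − step D E′ s U| ≤ r`.  The channel is the curly bracket of (2.12) p. 268,
LINEAR in the old action ([Balaban1988RG2Cluster] (1.33) p. 9), composed with §1: at this level there is no analyticity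
radius in the old activity and no smallness rider — the contraction NE9-FADE is to be fed into `r`. [folklore] -/
theorem FluctStep.abs_step_sub_step_le_of_oldAction (D : FluctStep Ω Bg) (hcut : MeasurableSet D.cut)
    {E E' : Bg → ℝ} {s : ℝ} {U : Bg}
    (hint : Integrable (fun B => Real.exp (D.exponent E s U B)) (D.μ.restrict D.cut))
    (hint' : Integrable (fun B => Real.exp (D.exponent E' s U B)) (D.μ.restrict D.cut))
    (hpos : 0 < ∫ B in D.cut, Real.exp (D.exponent E s U B) ∂D.μ) {r : ℝ}
    (h : ∀ B ∈ D.cut, |(E (D.shift s B U) - E U) - (E' (D.shift s B U) - E' U)| ≤ r) :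
    |D.step E s U - D.step E' s U| ≤ r := by
  refine abs_logFluct_sub_le hcut hint hint' hpos fun B hB => ?_
  have heq : D.exponent E s U B - D.exponent E' s U B =
      (E (D.shift s B U) - E U) - (E' (D.shift s B U) - E' U) := by
    simp only [FluctStep.exponent]; ring
  rw [heq]
  exact h B hB

/-- **BOTH CHANNELS** (two admissible old actions `E`, `E′` at two last couplings `s`, `s′`): the triangle inequality through
`step D E′ s U`.  `|step D E s U − step D E′ s′ U| ≤ r + (mP + CU′·cB)·|s − s′|` where `r` bounds the fluctuation
difference of `E − E′` and `CU′` is the background-Lipschitz constant of `E′`. [folklore] -/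
theorem FluctStep.abs_step_sub_step_le (D : FluctStep Ω Bg) (hcut : MeasurableSet D.cut) (gauge : Bg → Bg → ℝ)
    {E E' : Bg → ℝ} {s s' : ℝ} {U : Bg}
    (hEs : Integrable (fun B => Real.exp (D.exponent E s U B)) (D.μ.restrict D.cut))
    (hE's : Integrable (fun B => Real.exp (D.exponent E' s U B)) (D.μ.restrict D.cut))
    (hE's' : Integrable (fun B => Real.exp (D.exponent E' s' U B)) (D.μ.restrict D.cut))
    (hpos : 0 < ∫ B in D.cut, Real.exp (D.exponent E s U B) ∂D.μ)
    (hpos' : 0 < ∫ B in D.cut, Real.exp (D.exponent E' s U B) ∂D.μ) {r mP cB CU : ℝ}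
    (hr : ∀ B ∈ D.cut, |(E (D.shift s B U) - E U) - (E' (D.shift s B U) - E' U)| ≤ r)
    (hP : ∀ B ∈ D.cut, |D.vertex s U B - D.vertex s' U B| ≤ mP * |s - s'|)
    (hshift : ∀ B ∈ D.cut, gauge (D.shift s B U) (D.shift s' B U) ≤ cB * |s - s'|)
    (hE' : ∀ V V' : Bg, |E' V - E' V'| ≤ CU * gauge V V') (hCU : 0 ≤ CU) :
    |D.step E s U - D.step E' s' U| ≤ r + (mP + CU * cB) * |s - s'| := by
  have h1 := D.abs_step_sub_step_le_of_oldAction hcut hEs hE's hpos hr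
  have h2 := D.abs_step_sub_step_le_of_lastCoupling hcut gauge hE's hE's' hpos' hP hshift hE' hCU
  calc |D.step E s U - D.step E' s' U|
      = |(D.step E s U - D.step E' s U) + (D.step E' s U - D.step E' s' U)| := by ring_nf
    _ ≤ |D.step E s U - D.step E' s U| + |D.step E' s U - D.step E' s' U| := abs_add_le _ _
    _ ≤ r + (mP + CU * cB) * |s - s'| := add_le_add h1 h2

/-! ## §3 The one-step history inequality (the format of `T4HistoryLipschitzRecursion.StepLipschitz`, one step, global) -/

/-- THE HISTORY FORM.  Old actions indexed by coupling histories `g : ℕ → ℝ` (the action accumulated before step `k`,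
depending on `g_0, …, g_{k−1}`), the step run at the last coupling `g k`: `out D E k g U = step D (E g) (g k) U` — the
new term as a functional of the whole history. [folklore] -/
noncomputable def FluctStep.out (D : FluctStep Ω Bg) (E : (ℕ → ℝ) → Bg → ℝ) (k : ℕ) (g : ℕ → ℝ) (U : Bg) : ℝ :=
  D.step (E g) (g k) U

/-- **ONE-STEP HISTORY INEQUALITY (scheme (IV), global, positive measure).**  For two histories `g`, `g′`: the new terms
differ by at most `(mP + CU·cB)·|g_k − g′_k|` (last-coupling channel: vertex constant + background-Lipschitz constant of
the old action × shift amplitude) PLUS the fluctuation difference `r` of the old-action discrepancy `E g − E g′` over the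
cut-off set (old-action channel, constant one).  In `T4HistoryLipschitzRecursion.StepLipschitz` the first summand is
`lam k·|g_k − g′_k|` and the second is what the contraction profile `Σ_j a k j·D j` (NE9-FADE, NOT PRINTED) must bound;
nothing here supplies that contraction. [folklore] -/
theorem FluctStep.abs_out_sub_out_le (D : FluctStep Ω Bg) (hcut : MeasurableSet D.cut) (gauge : Bg → Bg → ℝ)
    {E : (ℕ → ℝ) → Bg → ℝ} {k : ℕ} {g g' : ℕ → ℝ} {U : Bg}
    (h1 : Integrable (fun B => Real.exp (D.exponent (E g) (g k) U B)) (D.μ.restrict D.cut))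
    (h2 : Integrable (fun B => Real.exp (D.exponent (E g') (g k) U B)) (D.μ.restrict D.cut))
    (h3 : Integrable (fun B => Real.exp (D.exponent (E g') (g' k) U B)) (D.μ.restrict D.cut))
    (hpos : 0 < ∫ B in D.cut, Real.exp (D.exponent (E g) (g k) U B) ∂D.μ)
    (hpos' : 0 < ∫ B in D.cut, Real.exp (D.exponent (E g') (g k) U B) ∂D.μ)
    {r mP cB CU : ℝ}
    (hr : ∀ B ∈ D.cut, |(E g (D.shift (g k) B U) - E g U) - (E g' (D.shift (g k) B U) - E g' U)| ≤ r)
    (hP : ∀ B ∈ D.cut, |D.vertex (g k) U B - D.vertex (g' k) U B| ≤ mP * |g k - g' k|)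
    (hshift : ∀ B ∈ D.cut, gauge (D.shift (g k) B U) (D.shift (g' k) B U) ≤ cB * |g k - g' k|)
    (hE' : ∀ V V' : Bg, |E g' V - E g' V'| ≤ CU * gauge V V') (hCU : 0 ≤ CU) :
    |D.out E k g U - D.out E k g' U| ≤ (mP + CU * cB) * |g k - g' k| + r := by
  have h := D.abs_step_sub_step_le hcut gauge h1 h2 h3 hpos hpos' hr hP hshift hE' hCU
  simp only [FluctStep.out]
  linarith

/-! ## §4 Currency: the shift amplitude under the printed small-field bound, and the `t = 1/g²` modulus -/

omit [MeasurableSpace Ω] in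
/-- THE SHIFT AMPLITUDE UNDER THE PRINTED SMALL-FIELD BOUND.  If on the cut-off set the (transported) fluctuation obeys
`|CB| ≤ ε₁/s₀` (the printed domain `{B : |B| < ε₁ g_k^{−1}}` of [Balaban1988RG2Cluster] (1.34) p. 9 at the smallest coupling
`s₀` of the window) and the shift is `L_sh`-Lipschitz in the amplitude `s·CB` for the gauge, then the shift moves by at most
`(L_sh·ε₁/s₀)·|s − s′|`: the constant `cB` of §2 is of order `ε₁/g_k` — a `1/g`-modulus in the coupling. [folklore] -/
theorem shift_amplitude_le {gauge : Bg → Bg → ℝ} {shift : ℝ → Ω → Bg → Bg} {load : Ω → ℝ} {S : Set Ω}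
    {Lsh ε₁ s₀ : ℝ} (hL : 0 ≤ Lsh)
    (hload : ∀ B ∈ S, |load B| ≤ ε₁ / s₀)
    (hshift : ∀ B ∈ S, ∀ (U : Bg) (s s' : ℝ), gauge (shift s B U) (shift s' B U) ≤ Lsh * |s * load B - s' * load B|)
    (B : Ω) (hB : B ∈ S) (U : Bg) (s s' : ℝ) :
    gauge (shift s B U) (shift s' B U) ≤ Lsh * (ε₁ / s₀) * |s - s'| := by
  have h := hshift B hB U s s'
  have hfac : |s * load B - s' * load B| = |s - s'| * |load B| := by rw [← sub_mul, abs_mul]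
  rw [hfac] at h
  calc gauge (shift s B U) (shift s' B U) ≤ Lsh * (|s - s'| * |load B|) := h
    _ ≤ Lsh * (|s - s'| * (ε₁ / s₀)) :=
        mul_le_mul_of_nonneg_left (mul_le_mul_of_nonneg_left (hload B hB) (abs_nonneg _)) hL
    _ = Lsh * (ε₁ / s₀) * |s - s'| := by ring

/-- `t`-CURRENCY.  A `1/g`-modulus in the coupling is a BOUNDED (indeed small) modulus in `t = 1/g²` on the window
`0 < g, g′ ≤ γ`: `(1/min(g,g′))·|g − g′| ≤ (γ²/2)·|g⁻² − g′⁻²|` — since `|g⁻² − g′⁻²| = |g − g′|(g + g′)/(g²g′²)` and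
`2·g²g′² ≤ γ²·(g + g′)·min(g, g′)`.  (Compare `T4CouplingAnalyticity.abs_sub_le_of_window`, the `γ³/2` version without the
`1/min` weight.)  So scheme (IV)'s last-coupling modulus `(mP + CU·ε₁‖C‖/g_k)` is harmless in the `t`-currency in which node
U2 matches couplings (`T4CouplingMatching.disc`). [folklore] -/
theorem inv_min_mul_abs_sub_le {g g' γ : ℝ} (hg : 0 < g) (hgγ : g ≤ γ) (hg' : 0 < g') (hg'γ : g' ≤ γ) :
    (min g g')⁻¹ * |g - g'| ≤ γ ^ 2 / 2 * |(g ^ 2)⁻¹ - (g' ^ 2)⁻¹| := by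
  have hm : 0 < min g g' := lt_min hg hg'
  have hgg : 0 < g ^ 2 * g' ^ 2 := by positivity
  have hid : (g ^ 2)⁻¹ - (g' ^ 2)⁻¹ = (g' - g) * (g' + g) / (g ^ 2 * g' ^ 2) := by
    field_simp
    ring
  rw [hid, abs_div, abs_mul, abs_of_pos hgg, abs_of_pos (by linarith : 0 < g' + g), abs_sub_comm g' g]
  rw [inv_mul_le_iff₀ hm]
  -- goal: |g - g'| ≤ min g g' * (γ^2/2 * (|g - g'| * (g' + g) / (g^2 * g'^2)))
  have hkey : g ^ 2 * g' ^ 2 ≤ γ ^ 2 / 2 * ((g' + g) * min g g') := by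
    rcases le_total g g' with h | h
    · rw [min_eq_left h]
      have A : g' ^ 2 ≤ γ ^ 2 := pow_le_pow_left₀ hg'.le hg'γ 2
      have A' : g ^ 2 * g' ^ 2 ≤ g ^ 2 * γ ^ 2 := mul_le_mul_of_nonneg_left A (sq_nonneg g)
      have B : 0 ≤ γ ^ 2 * (g * (g' - g)) :=
        mul_nonneg (sq_nonneg γ) (mul_nonneg hg.le (sub_nonneg.mpr h))
      nlinarith [A', B]
    · rw [min_eq_right h]
      have A : g ^ 2 ≤ γ ^ 2 := pow_le_pow_left₀ hg.le hgγ 2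
      have A' : g ^ 2 * g' ^ 2 ≤ γ ^ 2 * g' ^ 2 := mul_le_mul_of_nonneg_right A (sq_nonneg g')
      have B : 0 ≤ γ ^ 2 * (g' * (g - g')) :=
        mul_nonneg (sq_nonneg γ) (mul_nonneg hg'.le (sub_nonneg.mpr h))
      nlinarith [A', B]
  have habs : 0 ≤ |g - g'| := abs_nonneg _
  rw [show min g g' * (γ ^ 2 / 2 * (|g - g'| * (g' + g) / (g ^ 2 * g' ^ 2))) =
      |g - g'| * ((γ ^ 2 / 2 * ((g' + g) * min g g')) / (g ^ 2 * g' ^ 2)) by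
    field_simp]
  have hge1 : 1 ≤ (γ ^ 2 / 2 * ((g' + g) * min g g')) / (g ^ 2 * g' ^ 2) := by
    rw [le_div_iff₀ hgg, one_mul]; exact hkey
  calc |g - g'| = |g - g'| * 1 := (mul_one _).symm
    _ ≤ |g - g'| * ((γ ^ 2 / 2 * ((g' + g) * min g g')) / (g ^ 2 * g' ^ 2)) :=
        mul_le_mul_of_nonneg_left hge1 habs


/-! ## §5 (v1.1, APPEND-ONLY) The CUT-OFF channel at positive measure: moving the cut-off set costs (shell mass)/(core mass)

In the final variables the printed cut-off is `χ_k = Π_b χ(|B(b)| < ε₁/g_k)` ([Balaban1988RG2Cluster] (2.3) p. 12 prints the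
complementary functions `χ({|B(b)| ≥ ε₁/g_k})`), so two last couplings `s < s′` give NESTED cut-off sets `S′ ⊆ S` differing by
the small-field SHELL `{ε₁/s′ ≤ |B(b)| < ε₁/s for some b}`.  At a REAL background with POSITIVE measure the cost of this motion
on the GLOBAL functional is elementary: `0 ≤ logFluct μ S F − logFluct μ S′ F ≤ e^{2M}·μ(S ∖ S′)/μ(S′)` for an exponent bounded by
`M` on `S` (`logFluct_mono_set`, `logFluct_sub_logFluct_le_shell`) — the shell mass `μ(S ∖ S′)` being the printed-type Gaussian
tail.  So ALL THREE channels of the last coupling (vertex/shift §2, old action §2, cut-off §5) are elementary at this level;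
what is NOT is their LOCALIZED form through the expansion of [Balaban1988RG2Cluster] §2 (cell items [S1-c], [S2-LR], and the
localized shell estimate NE9-CUT; record `t4/T4-EST-NE9-P1.md` §24, 24.7–24.8).  Nothing printed is used; [folklore]. -/

/-- MONOTONICITY IN THE CUT-OFF SET: for `S′ ⊆ S` with `e^F` integrable over `S` and a positive fluctuation integral over
`S′`, `logFluct μ S′ F ≤ logFluct μ S F`. [folklore] -/
theorem logFluct_mono_set {μ : Measure Ω} {S S' : Set Ω} (hS'S : S' ⊆ S) {F : Ω → ℝ}
    (hint : Integrable (fun B => Real.exp (F B)) (μ.restrict S))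
    (hpos' : 0 < ∫ B in S', Real.exp (F B) ∂μ) :
    logFluct μ S' F ≤ logFluct μ S F := by
  unfold logFluct
  refine Real.log_le_log hpos' ?_
  exact setIntegral_mono_set hint (Filter.Eventually.of_forall fun B => (Real.exp_pos _).le)
    (Filter.Eventually.of_forall hS'S)

/-- **THE CUT-OFF CHANNEL AT POSITIVE MEASURE.**  Finite fluctuation measure, measurable cut-off sets `S′ ⊆ S`, exponent
a.e.-strongly measurable and bounded by `M` on `S`, core mass `μ(S′) > 0`: then
`logFluct μ S F − logFluct μ S′ F ≤ e^{2M}·μ(S ∖ S′)/μ(S′)` — (shell integral ≤ `e^{M}·μ(S ∖ S′)`) over (core integral ≥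
`e^{−M}·μ(S′)`), through `log(1 + x) ≤ x`.  With §2 this makes every channel of the last coupling elementary for the GLOBAL
functional at real backgrounds; the localized shell estimate NE9-CUT (through the expansion) is NOT this lemma. [folklore] -/
theorem logFluct_sub_logFluct_le_shell {μ : Measure Ω} [IsFiniteMeasure μ] {S S' : Set Ω} (hS'S : S' ⊆ S)
    (hS : MeasurableSet S) (hS' : MeasurableSet S') {F : Ω → ℝ} (hF : AEStronglyMeasurable F (μ.restrict S))
    {M : ℝ} (hM : ∀ B ∈ S, |F B| ≤ M) (hcore : 0 < μ.real S') :
    logFluct μ S F - logFluct μ S' F ≤ Real.exp (2 * M) * μ.real (S \ S') / μ.real S' := by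
  have hintS : Integrable (fun B => Real.exp (F B)) (μ.restrict S) := integrable_exp_restrict μ hS hF hM
  have hintS0 : IntegrableOn (fun B => Real.exp (F B)) S μ := hintS
  have hintS' : IntegrableOn (fun B => Real.exp (F B)) S' μ := hintS0.mono_set hS'S
  have hintD : IntegrableOn (fun B => Real.exp (F B)) (S \ S') μ := hintS0.mono_set Set.sdiff_subset
  -- the core integral is ≥ e^{-M} μ(S′) > 0
  have hIlow : Real.exp (-M) * μ.real S' ≤ ∫ B in S', Real.exp (F B) ∂μ := by
    have h := setIntegral_ge_of_const_le (c := Real.exp (-M)) hS' (measure_ne_top μ S') (fun B hB => ?_) hintS'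
    · rw [smul_eq_mul, mul_comm] at h
      exact h
    exact Real.exp_le_exp.mpr (neg_le.mpr ((neg_le_abs _).trans (hM B (hS'S hB))))
  have hIpos : 0 < ∫ B in S', Real.exp (F B) ∂μ := lt_of_lt_of_le (mul_pos (Real.exp_pos _) hcore) hIlow
  -- the shell integral is ≤ e^{M} μ(S ∖ S′)
  have hJup : ∫ B in S \ S', Real.exp (F B) ∂μ ≤ Real.exp M * μ.real (S \ S') := by
    have h1 : ∫ B in S \ S', Real.exp (F B) ∂μ ≤ ∫ B in S \ S', Real.exp M ∂μ := by
      refine setIntegral_mono_on hintD (integrableOn_const) (hS.diff hS') fun B hB => ?_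
      exact Real.exp_le_exp.mpr ((le_abs_self _).trans (hM B hB.1))
    rw [setIntegral_const, smul_eq_mul] at h1
    linarith
  have hJnn : 0 ≤ ∫ B in S \ S', Real.exp (F B) ∂μ := setIntegral_nonneg (hS.diff hS') fun B _ => (Real.exp_pos _).le
  -- splitting S = S′ ∪ (S ∖ S′)
  have hsplit : ∫ B in S, Real.exp (F B) ∂μ = (∫ B in S', Real.exp (F B) ∂μ) + ∫ B in S \ S', Real.exp (F B) ∂μ := by
    rw [← setIntegral_union disjoint_sdiff_self_right (hS.diff hS') hintS' hintD, Set.union_sdiff_cancel hS'S]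
  -- log(I + J) - log I ≤ J / I ≤ e^{2M} μ(S∖S′)/μ(S′)
  set I := ∫ B in S', Real.exp (F B) ∂μ with hI
  set J := ∫ B in S \ S', Real.exp (F B) ∂μ with hJ
  have hlog : Real.log (I + J) - Real.log I ≤ J / I := by
    have hq : (I + J) / I = 1 + J / I := by rw [add_div, div_self hIpos.ne']
    rw [← Real.log_div (by linarith) hIpos.ne', hq]
    have := Real.log_le_sub_one_of_pos (show 0 < 1 + J / I by positivity)
    linarith
  have hratio : J / I ≤ Real.exp (2 * M) * μ.real (S \ S') / μ.real S' := by
    rw [div_le_div_iff₀ hIpos (by exact hcore)]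
    have hcoreI : μ.real S' ≤ Real.exp M * I := by
      have := mul_le_mul_of_nonneg_left hIlow (Real.exp_pos M).le
      rw [← mul_assoc, ← Real.exp_add, add_neg_cancel, Real.exp_zero, one_mul] at this
      exact this
    calc J * μ.real S' ≤ (Real.exp M * μ.real (S \ S')) * (Real.exp M * I) :=
          mul_le_mul hJup hcoreI hcore.le (by positivity)
      _ = Real.exp (2 * M) * μ.real (S \ S') * I := by rw [two_mul, Real.exp_add]; ring
  unfold logFluct
  rw [hsplit]
  exact hlog.trans hratio
end Summit.QuantumFields.BalabanUV.T4Continuum.NE9FluctuationStep
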